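import Mathlib
import Literature.MathematicalPhysics.QuantumFieldTheory.Balaban1983to89.T4DilationAperture
import Literature.Probability.LatticeModels.ClusterExpansion

/-!
# T4DilationKP — the EXPANSION BRANCH of the NOT-PRINTED dilation hypothesis [H-dil-N] of node U3 (estimate NE9), on the
tree's kernel-proved KOTECKÝ–PREISS polymer gas: if the activities of a polymer gas depend holomorphically on the complex
coupling `z` and the Kotecký–Preiss condition holds UNIFORMLY IN `z` on a set containing the dilation discs `|z − s| ≤ c·s`,
`s ≥ t₀`, then the reduced activity `ρ_D(z) = Z(Λ ∖ D; z)/Z(Λ; z)` of every localised piece `D` is holomorphic there with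
the two-sided bound `e^{∓Σ_{γ∈D} a(γ)}` and the real-coupling Lipschitz constant `4e^{Σ_D a}/(c t₀)` — UNIFORMLY IN THE
VOLUME `Λ`: the `hlast` shape per piece WITHOUT the volume factor `e^{a(c)·ν}` that the domination branch
(`T4DilationAperture`) cannot avoid; and the dilation's volume rate `a(c) = −¼log(1 − c²)` is charged PER POLYMER to the KP
size function (`isKPOn_of_dominated`), so the aperture condition becomes local.  Composes BY NAME with generation 8's
one-block integrals (`act_polymerGas_dilationAnalytic`).  (Cell `pub-balaban`, T4-DAG §2 node U3 / §6 NE9; journal row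
T4-U3.E-NE9-PROVE-P1j*; MODEL statements about abstract polymer gases and toy block integrals with explicit constants, NO
estimate of the cell's NEW-ESTIMATE kind for Bałaban's expansions, NOT summit progress.)

HONEST FRAMING (T4-DAG PAGE 1).  The cell's T4 target is rung (B)+1: existence AND uniqueness of the ε → 0 limit of
Bałaban's unit-scale averaged expectations on a FIXED finite torus — strictly beyond ultraviolet stability
([Balaban1988Convergent] Cor. 3 p. 264; [Balaban1989LargeFieldII] Thm 1 p. 355), and NOT infinite volume, NOT a mass gap,
NOT the Clay problem; the hypotheses BetaPertH, (B), (B^μ) of the cell's chain stay explicit and are untouched here (this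
module uses none of them).  NE9 is NOT PRINTED (cell NEW ESTIMATE).  This module ASSERTS NOTHING about Bałaban's functionals
or expansions: every declaration is [folklore] — finite sums, quotients and elementary inequalities — over the ABSTRACT
polymer gas of [KoteckyPreiss1986] as formalised and KERNEL-PROVED in the tree (`Literature.Probability.LatticeModels.
PolymerGas`, `….ClusterExpansion`: zero-freeness and ratio bounds under the finite-volume KP condition — a PUBLISHED result
outside the audited series, used BY NAME, never as a hypothesis), and over the one-block model of `T4ComplexDilation`.  The
manuscripts under audit are named for STRUCTURE only (ABSOLUTE RULE: no internally-minted statement enters as a cited fact).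

WHAT THIS LEAF ADDS AND WHY.  `T4DilationAperture` (this lineage, generation 10) priced the aperture `c` of [H-dil-N] on the
DOMINATION branch (absolute values inside the fluctuation integral after complex dilation): decay of localised pieces
survives only if `a(c)·ν < κ` (`ν` fluctuation variables per unit of size), the Lipschitz constant carries
`e^{a(c)ν}/c ≥ √(eν/2)`, and an honest family attains the loss; it also showed that the volume factor is absent for
Fourier-class insertions, and recorded as [analysis] that n-uniform complex-coupling bounds «require exploiting the structure
of the insertions, as a cluster expansion does».  THIS LEAF TYPES THAT CLAUSE on the one convergent expansion the tree owns in
kernel form: (§1) a polymer gas with coupling-dependent activities `w γ z`, its partition function `cZ` holomorphic where the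
activities are (`differentiableOn_cZ`), and the typed MODEL FORM OF [H-dil-N] ON THIS BRANCH — `IsKPOn inc w a Λ U`: the KP
condition for the COMPLEX-coupling activities, uniformly on `U`; (§2) the reduced activity `pieceRatio` of a piece `D`:
holomorphic on `U` (`differentiableOn_pieceRatio`, zero-free denominators by the tree's `polymerPartitionFunction_ne_zero_of_kp`),
`e^{−Σ_D a} ≤ ‖ρ_D(z)‖ ≤ e^{Σ_D a}` for EVERY volume `Λ ⊇ D` (`norm_pieceRatio_le`, `exp_neg_le_norm_pieceRatio`, from the
tree's telescoped KP ratio bounds), and its logarithm named as the cluster sum through `D` (`pieceRatio_eq_exp`, tree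
`polymerPartitionFunction_sdiff_div_eq_exp`); (§3) THE `hlast` SHAPE ON THE EXPANSION BRANCH — `pieceRatio_dilationAnalytic`:
`∃ Dm, DifferentiableOn ℂ ρ_D Dm ∧ (∀ z ∈ Dm, ‖ρ_D z‖ ≤ e^{Σ_D a}) ∧ ∀ s ≥ t₀, closedBall s (c s) ⊆ Dm`, literally the binder
`hlast` of `T4CouplingAnalyticity.stepTransfer_of_analyticOn` per piece with a VOLUME-INDEPENDENT constant, and
`pieceRatio_lipschitz` / `pieceRatio_lipschitz_allVolumes` (`Dimock2015.real_param_lipschitz` BY NAME): Lipschitz constant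
`4e^{Σ_D a}/(c t₀)` in every volume — the `1/c` of Cauchy stays, the `e^{a(c)ν}` is gone; (§4) WHERE THE APERTURE WENT —
`isKPOn_of_dominated`: if each complex activity is DOMINATED after dilation, `‖w γ z‖ ≤ dilVol c (n γ)·B γ` (the shape of
`T4ComplexDilation.norm_act_le`, `n γ` variables in the polymer), then uniform KP on `U` follows from the REAL data satisfying
KP with the size function enlarged by the volume rate PER POLYMER, `Σ_{γ' ι γ} B γ'·e^{a γ' + a(c)·n γ'} ≤ a γ`
(`dilVol_eq_exp`); `dominated_weight_le`: with `n ≤ ν·ℓ` variables and `B ≤ K e^{−κ₀ ℓ}` the charged weight is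
`≤ K e^{−(κ₀ − a(c)ν)ℓ}` — the SAME threshold structure `a(c)·ν < κ₀` as the aperture leaf, but LOCAL (per polymer, against the
expansion's margin) instead of global (per unit of the final bound, against the volume); (§4b) THE LOOP CLOSED WITH GENERATION 8
BY NAME — `act_dominated_on_dilDom` (`norm_act_le` on `dilDom t₀ c`) and `act_polymerGas_dilationAnalytic`: a polymer gas whose
activities ARE the one-block integrals `act (A γ) (μ γ) (f γ) (S γ)` with real-coupling bounds `B γ` on `r ≥ (1 − c)t₀` and real
KP data enlarged per polymer has, for every piece, the `hlast` shape with constant `e^{Σ_D a}` — the very objects whose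
domination bound alone forces `a(c)·ν < κ` globally (`T4DilationAperture.act_family_dilationAnalytic`, `witness_no_decay`);
(§5) NON-VACUITY — the one-polymer system with activity `ε e^{−z}`, `0 ≤ ε ≤ e^{−1}`, satisfies uniform KP (`a ≡ 1`) on the
closed right half-plane, which contains all dilation discs (`isKPOn_expActivity`, `closedBall_subset_halfPlane`), and §3 fires
on it (`expActivity_lipschitz`).  READING [analysis, not a claim about print]: on the expansion branch [H-dil-N] IS a
convergence criterion for complex-coupling activities uniform on the discs (`IsKPOn`-type), and the aperture it tolerates is
set polymer by polymer by the margin of that criterion; whether Bałaban's 𝐑-operation / B13 expansion admits such a criterion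
at complex COUPLING (print runs it at complex interpolation parameters `σ(Z), τ` and complex backgrounds, see DICTIONARY) is
exactly what is NOT PRINTED.

DICTIONARY (model ↦ print; an ANALOGY fixing what is modelled, NOT an identification; transcriptions from renders in the cell
record `t4/T4-EST-NE9-P1.md` §2/§7, cross-read): polymers `γ`, volume `Λ`, piece `D` ↦ the localisation domains `Y ∈ D_k` /
`X` of [Balaban1988RG2Cluster] p. 9 Lemma 1 (1.33)–(1.36) (record (P8): localized terms `V′_k(Y, U, J, B)` with
*"|V′_k(Y, U, J, B)| ≤ E₀ε₁C₁M^q exp C₂κ₁ exp(−(1 − 2δ)κd_k(Y))"* (1.36)) and of [Balaban1987RG1] p. 258 (0.27)/(0.29); the KP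
size function `a γ` and the decay of `B γ` ↦ the exponential decay `exp(−κ d_k(Y))` that makes such expansions converge;
`IsKPOn … U` (KP at COMPLEX coupling) ↦ NOT PRINTED — print's complex parameters are the interpolation parameters and
backgrounds: p. 15 (record (P9)) *"We consider it as an analytic function of (U, J) in the space U^c_{k+1}(X, α₀, α₁), and of
the complex parameters σ(Z), τ. This complicates estimates of this expression, because the operators in it are not symmetric,
and the second measure is complex."*; `z` ↦ the last coupling `t = 1/g²` of [H-dil-N]; `act`, `absAct`, `dilVol`, `volRate`
↦ as in `T4ComplexDilation` / `T4DilationAperture`.  The abstract KP gas is NOT Bałaban's expansion (his is a multi-scale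
expansion with 𝐑-operation and large-field holes); the model isolates the MECHANISM by which ANY convergent expansion absorbs
the complex-dilation volume factor locally.

## What is typed and proved (all [folklore]; 0 sorry)

§1 `cZ`, **`differentiableOn_cZ`**, **`IsKPOn`** (the branch's model form of [H-dil-N]), `IsKPOn.mono`, `cZ_ne_zero`.
§2 `pieceRatio`, **`differentiableOn_pieceRatio`**, `sum_kpTerm_le_sum`, **`norm_pieceRatio_le`** (`≤ e^{Σ_D a}`, every volume),
   `exp_neg_le_norm_pieceRatio`, `pieceRatio_eq_exp` (the cluster sum named).
§3 **`pieceRatio_dilationAnalytic`** (the `hlast` shape, volume-uniform constant), **`pieceRatio_lipschitz`** (`4e^{Σ_D a}/(c t₀)`),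
   `pieceRatio_lipschitz_allVolumes`.
§4 **`isKPOn_of_dominated`** (volume rate charged per polymer), `pieceRatio_dilationAnalytic_of_dominated`, `dominated_weight_le`
   (per-polymer threshold `a(c)·ν < κ₀`); §4b `act_dominated_on_dilDom`, **`act_polymerGas_dilationAnalytic`** (generation 8's
   one-block integrals as polymer activities).
§5 `topInc`, `expActivity`, **`isKPOn_expActivity`**, `differentiable_expActivity`, `closedBall_subset_halfPlane`,
   `expActivity_lipschitz`.

WHAT THIS SHOWS AND WHAT IT DOES NOT.  Shows (kernel, MODEL): the dichotomy of [H-dil-N]'s price is complete on the tree's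
objects — DOMINATION ties the aperture to the localisation globally (`T4DilationAperture`: `a(c)·ν < κ`, constant `e^{a(c)ν}`,
sharp), EXPANSION makes every constant volume-uniform and charges the volume rate per polymer to the convergence criterion,
whose complex-coupling validity is then THE hypothesis.  Does NOT show: that Bałaban's expansion satisfies a KP-type criterion
at complex coupling (NOT PRINTED: this is [H-dil-N] on this branch), any value of `a`, `κ₀`, `ν` for the printed scheme,
anything about large fields or the 𝐑-operation, nor NE9.  Holomorphy IN `z` of the KP LOGARITHM / truncated functionals is not
typed (the bounded holomorphic object used is the ratio `ρ_D`; its logarithm is only NAMED pointwise by `pieceRatio_eq_exp`).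
The typed wall of node U3 is UNCHANGED: `hlast` of `T4CouplingAnalyticity.stepTransferV_of_analyticOn` for Bałaban's step,
(W2)–(W4), G-ne9p1-13 (record §4, §16, §17) — this leaf adds the branch-resolved reading of [H-dil-N]: domination branch =
aperture rider (UPDATE 8), expansion branch = `IsKPOn`-type criterion at complex coupling (UPDATE 9).

CITATION HEADER (lean-in-tree rule 2026-08-18).  Kernel input used BY NAME (published, outside the audited series, proved in
the tree): R. Kotecký, D. Preiss, *Cluster expansion for abstract polymer models*, Commun. Math. Phys. **103** (1986) 491–498
[KoteckyPreiss1986] — via `Literature.Probability.LatticeModels.{PolymerGas, ClusterExpansion}` (`polymerPartitionFunction`,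
`IsKPVolume`, `kpTerm`, `polymerPartitionFunction_ne_zero_of_kp`, `norm_polymerPartitionFunction_sdiff_div_le_of_kp`,
`le_norm_polymerPartitionFunction_sdiff_div_of_kp`, `sum_kpTerm_le_sum_of_incompatible`, `polymerPartitionFunction_sdiff_div_eq_exp`,
`truncatedWeight`).  Sources quoted for STRUCTURE/CONTEXT only: T. Bałaban, *Renormalization group approach to lattice gauge
field theories. II. Cluster expansions*, Commun. Math. Phys. **116**, 1–22 (1988) [Balaban1988RG2Cluster] (cell paper B13;
pp. 9, 15 as above); [Balaban1987RG1] (B12) p. 258.  Named for framing only: [Balaban1988Convergent] (B14),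
[Balaban1989LargeFieldII] (B16).  The Bałaban papers are manuscripts UNDER ADJUDICATION by the audit cell `pub-balaban`:
NOTHING printed in them is asserted here.  Further kernel inputs BY NAME: `T4DilationAperture` v1 (p191659: `volRate`,
`dilVol_eq_exp`, `volRate_nonneg`), `T4ComplexDilation` v1.1 (p189052: `act`, `absAct`, `dilVol`, `dilVol_nonneg`, `norm_act_le`,
`differentiableOn_act`, `dilDom`, `closedBall_subset_dilDom`, `dilDom_subset_re_pos`, `re_pos_of_mem_dilDisc`,
`normSq_mul_le_re_sq_of_mem_dilDisc`, `re_ge_of_mem_dilDisc`), `Dimock2015.AnalyticLipschitz.real_param_lipschitz` (J. Dimock's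
printed "analyticity ⇒ Lipschitz" mechanism [Dimock2015]/[DimockYuan2024GNFlow], PUBLISHED, outside the audited series);
Mathlib (`DifferentiableOn.finsetProd`, `DifferentiableOn.fun_sum`, `DifferentiableOn.div`); it modifies nothing.  NEW LEAF of
unit `b2b-balaban-t4-ne9-p1-g10` (NE9 prover P1, analytic-dependence route, generation 10; journal CLAIM T4-U3.E-NE9-PROVE-P1j*
2026-08-19T16:59:11Z; companion of `T4DilationAperture` v1 p191659); v1.
-/

noncomputable section

open Complex MeasureTheory Set Metric Finset
open scoped BigOperators
open Literature.Probability.LatticeModels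
open Literature.MathematicalPhysics.QuantumFieldTheory.Balaban1983to89.T4ComplexDilation
open Literature.MathematicalPhysics.QuantumFieldTheory.Balaban1983to89.T4DilationAperture

namespace Literature.MathematicalPhysics.QuantumFieldTheory.Balaban1983to89.T4DilationKP

variable {P : Type*} [DecidableEq P] {inc : P → P → Prop} [DecidableRel inc]

/-! ## §1  Polymer gases whose activities depend on a complex coupling -/

/-- The partition function of the finite volume `Λ` of a polymer gas whose activities `w γ z` depend on a complex
coupling `z`: `cZ inc w Λ z = Z(Λ; w(·, z)) = Σ_{X ⊆ Λ compatible} ∏_{γ ∈ X} w γ z` (the tree's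
`polymerPartitionFunction` at the activity vector `fun γ ↦ w γ z`). [folklore] -/
def cZ (inc : P → P → Prop) [DecidableRel inc] (w : P → ℂ → ℂ) (Λ : Finset P) (z : ℂ) : ℂ :=
  polymerPartitionFunction inc (fun γ => w γ z) Λ

/-- `Z(Λ; w(·, z))` is a polynomial in the activities, hence HOLOMORPHIC in the coupling wherever every activity of the
volume is. [folklore] -/
theorem differentiableOn_cZ (w : P → ℂ → ℂ) (Λ : Finset P) {U : Set ℂ}
    (hw : ∀ γ ∈ Λ, DifferentiableOn ℂ (w γ) U) : DifferentiableOn ℂ (cZ inc w Λ) U := by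
  unfold cZ polymerPartitionFunction
  refine DifferentiableOn.fun_sum fun A hA => ?_
  by_cases hc : IsCompatible inc A
  · simp only [hc, if_true]
    have e : (fun z => ∏ γ ∈ A, w γ z) = ∏ γ ∈ A, w γ := by ext z; simp [Finset.prod_apply]
    rw [e]
    exact DifferentiableOn.finsetProd fun γ hγ => hw γ (Finset.mem_powerset.1 hA hγ)
  · simp only [hc, if_false]
    exact differentiableOn_const 0

/-- **THE KOTECKÝ–PREISS CONDITION UNIFORMLY IN THE COMPLEX COUPLING** on a set `U ⊆ ℂ`: for every `z ∈ U` the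
activity vector `w(·, z)` satisfies the finite-volume KP condition of the tree (`IsKPVolume`:
`Σ_{γ' ∈ Λ, γ' ι γ} ‖w γ' z‖ e^{a γ'} ≤ a γ` for `γ ∈ Λ`) with ONE size function `a`.  This is the MODEL FORM, on the
expansion branch, of the NOT-PRINTED input [H-dil-N]: a convergence criterion for the COMPLEX-coupling activities,
uniform on the dilation discs. [folklore] -/
def IsKPOn (inc : P → P → Prop) [DecidableRel inc] (w : P → ℂ → ℂ) (a : P → ℝ) (Λ : Finset P) (U : Set ℂ) : Prop :=
  ∀ z ∈ U, IsKPVolume inc (fun γ => w γ z) a Λ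

omit [DecidableEq P] in
/-- Uniform KP is inherited by sub-volumes and subsets of couplings. [folklore] -/
theorem IsKPOn.mono {w : P → ℂ → ℂ} {a : P → ℝ} {Λ Λ' : Finset P} {U U' : Set ℂ} (h : IsKPOn inc w a Λ U)
    (hΛ : Λ' ⊆ Λ) (hU : U' ⊆ U) : IsKPOn inc w a Λ' U' :=
  fun z hz => (h z (hU hz)).mono hΛ

/-- Under uniform KP no partition function of a sub-volume vanishes at any coupling of `U` (tree:
`polymerPartitionFunction_ne_zero_of_kp`, [KoteckyPreiss1986] Theorem). [folklore] -/
theorem cZ_ne_zero [Std.Refl inc] [Std.Symm inc] {w : P → ℂ → ℂ} {a : P → ℝ} {Λ Λ' : Finset P} {U : Set ℂ}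
    (h : IsKPOn inc w a Λ U) (hΛ' : Λ' ⊆ Λ) {z : ℂ} (hz : z ∈ U) : cZ inc w Λ' z ≠ 0 :=
  polymerPartitionFunction_ne_zero_of_kp (h z hz) hΛ'

/-! ## §2  The reduced activity of a localised piece: `ρ_D(z) = Z(Λ ∖ D; z)/Z(Λ; z)` -/

/-- THE REDUCED ACTIVITY (Boltzmann ratio) of the localised piece `D` inside the volume `Λ` at coupling `z`:
`pieceRatio inc w Λ D z = Z(Λ ∖ D; w(·,z)) / Z(Λ; w(·,z))` — the factor by which removing the polymers of `D` changes the
partition function; under KP it equals `exp(−Σ_{C ⊆ Λ, C ∩ D ≠ ∅} Φ^T(C))` (`pieceRatio_eq_exp`), the exponential of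
minus the CLUSTER SUM through `D`, which is the expansion's version of «the activity of the piece `D`». [folklore] -/
def pieceRatio (inc : P → P → Prop) [DecidableRel inc] (w : P → ℂ → ℂ) (Λ D : Finset P) (z : ℂ) : ℂ :=
  cZ inc w (Λ \ D) z / cZ inc w Λ z

/-- The reduced activity is HOLOMORPHIC on `U` under uniform KP (quotient of polynomials in holomorphic activities with
a zero-free denominator). [folklore] -/
theorem differentiableOn_pieceRatio [Std.Refl inc] [Std.Symm inc] {w : P → ℂ → ℂ} {a : P → ℝ} {Λ : Finset P}
    {U : Set ℂ} (hw : ∀ γ ∈ Λ, DifferentiableOn ℂ (w γ) U) (h : IsKPOn inc w a Λ U) (D : Finset P) :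
    DifferentiableOn ℂ (pieceRatio inc w Λ D) U :=
  (differentiableOn_cZ w _ fun γ hγ => hw γ (Finset.sdiff_subset hγ)).div (differentiableOn_cZ w Λ hw)
    fun _ hz => cZ_ne_zero h (Finset.Subset.refl Λ) hz

omit [DecidableEq P] in
/-- In a KP volume the KP sizes of the polymers of `D ⊆ Λ` add up to at most `Σ_{γ ∈ D} a γ` (reflexivity: each `γ`
is incompatible with itself; tree `sum_kpTerm_le_sum_of_incompatible`). [folklore] -/
theorem sum_kpTerm_le_sum [Std.Refl inc] {w : P → ℂ} {a : P → ℝ} {Λ D : Finset P} (hKP : IsKPVolume inc w a Λ)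
    (hD : D ⊆ Λ) : ∑ γ ∈ D, kpTerm w a γ ≤ ∑ γ ∈ D, a γ :=
  sum_kpTerm_le_sum_of_incompatible hKP hD hD fun γ hγ => ⟨γ, hγ, Std.Refl.refl γ⟩

/-- **VOLUME-UNIFORM UPPER BOUND**: under uniform KP, `‖ρ_D(z)‖ ≤ exp(Σ_{γ ∈ D} a γ)` for every `z ∈ U` and EVERY
volume `Λ ⊇ D` — the constant sees the piece `D` only, never the number of polymers / fluctuation variables of `Λ`
(tree `norm_polymerPartitionFunction_sdiff_div_le_of_kp`, [KoteckyPreiss1986]; Friedli–Velenik (5.29)). [folklore] -/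
theorem norm_pieceRatio_le [Std.Refl inc] [Std.Symm inc] {w : P → ℂ → ℂ} {a : P → ℝ} {Λ D : Finset P}
    {U : Set ℂ} (h : IsKPOn inc w a Λ U) (hD : D ⊆ Λ) {z : ℂ} (hz : z ∈ U) :
    ‖pieceRatio inc w Λ D z‖ ≤ Real.exp (∑ γ ∈ D, a γ) :=
  (norm_polymerPartitionFunction_sdiff_div_le_of_kp (h z hz) (Finset.Subset.refl Λ) hD).trans
    (Real.exp_le_exp.2 (sum_kpTerm_le_sum (h z hz) hD))

/-- **VOLUME-UNIFORM LOWER BOUND**: `exp(−Σ_{γ ∈ D} a γ) ≤ ‖ρ_D(z)‖` (tree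
`le_norm_polymerPartitionFunction_sdiff_div_of_kp`). [folklore] -/
theorem exp_neg_le_norm_pieceRatio [Std.Refl inc] [Std.Symm inc] {w : P → ℂ → ℂ} {a : P → ℝ} {Λ D : Finset P}
    {U : Set ℂ} (h : IsKPOn inc w a Λ U) (hD : D ⊆ Λ) {z : ℂ} (hz : z ∈ U) :
    Real.exp (-∑ γ ∈ D, a γ) ≤ ‖pieceRatio inc w Λ D z‖ :=
  le_trans (Real.exp_le_exp.2 (neg_le_neg (sum_kpTerm_le_sum (h z hz) hD)))
    (le_norm_polymerPartitionFunction_sdiff_div_of_kp (h z hz) (Finset.Subset.refl Λ) hD)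

/-- THE LOGARITHM NAMED: under KP, `ρ_D(z) = exp(−Σ_{C ⊆ Λ, C ∩ D ≠ ∅} Φ^T_{w(·,z)}(C))`, the cluster sum through the
piece (tree `polymerPartitionFunction_sdiff_div_eq_exp`, [KoteckyPreiss1986] (5)). [folklore] -/
theorem pieceRatio_eq_exp [Std.Refl inc] [Std.Symm inc] {w : P → ℂ → ℂ} {a : P → ℝ} {Λ : Finset P} {U : Set ℂ}
    (h : IsKPOn inc w a Λ U) (D : Finset P) {z : ℂ} (hz : z ∈ U) :
    pieceRatio inc w Λ D z =
      Complex.exp (-∑ C ∈ Λ.powerset with (C ∩ D).Nonempty, truncatedWeight inc (fun γ => w γ z) C) :=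
  polymerPartitionFunction_sdiff_div_eq_exp (h z hz)

/-! ## §3  THE EXPANSION BRANCH OF `hlast`: analytic on the dilation discs, bound `e^{Σ_D a}`, NO volume factor -/

/-- **THE `hlast` SHAPE ON THE EXPANSION BRANCH.**  If the activities are holomorphic on a set `U` containing every
dilation disc `|z − s| ≤ c·s`, `s ≥ t₀`, and the KP condition holds UNIFORMLY on `U`, then the reduced activity of
every piece `D ⊆ Λ` is holomorphic on a set containing the discs and bounded there by `exp(Σ_{γ ∈ D} a γ)`:
`∃ Dm, DifferentiableOn ℂ ρ_D Dm ∧ (∀ z ∈ Dm, ‖ρ_D z‖ ≤ e^{Σ_D a}) ∧ ∀ s ≥ t₀, closedBall s (c·s) ⊆ Dm` — literally the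
binder `hlast` of `T4CouplingAnalyticity.stepTransfer_of_analyticOn` per localised piece, with a constant that does NOT
depend on the volume `Λ` (contrast: `T4DilationAperture.act_family_dilationAnalytic`, constant `M·e^{a(c)·ν}`).
ASSERTS NOTHING about Bałaban's expansions. [folklore] -/
theorem pieceRatio_dilationAnalytic [Std.Refl inc] [Std.Symm inc] {w : P → ℂ → ℂ} {a : P → ℝ} {Λ D : Finset P}
    {U : Set ℂ} {t₀ c : ℝ} (hU : ∀ s ∈ Set.Ici t₀, closedBall (s : ℂ) (c * s) ⊆ U)
    (hw : ∀ γ ∈ Λ, DifferentiableOn ℂ (w γ) U) (h : IsKPOn inc w a Λ U) (hD : D ⊆ Λ) :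
    ∃ Dm : Set ℂ, DifferentiableOn ℂ (pieceRatio inc w Λ D) Dm ∧
      (∀ z ∈ Dm, ‖pieceRatio inc w Λ D z‖ ≤ Real.exp (∑ γ ∈ D, a γ)) ∧
      ∀ s ∈ Set.Ici t₀, closedBall (s : ℂ) (c * s) ⊆ Dm :=
  ⟨U, differentiableOn_pieceRatio hw h D, fun _ hz => norm_pieceRatio_le h hD hz, hU⟩

/-- **CAUCHY ⇒ LIPSCHITZ IN THE REAL COUPLING, VOLUME-UNIFORMLY** (`Dimock2015.real_param_lipschitz` BY NAME on the
discs of radius `c·t₀`): `‖ρ_D(s) − ρ_D(s′)‖ ≤ (4·e^{Σ_D a}/(c·t₀))·|s − s′|` for `s, s′ ≥ t₀` — the last-coupling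
Lipschitz constant `ℓ = 4M₁/(c t₀)` of the lineage's `StepTransfer` with `M₁ = e^{Σ_D a}` INDEPENDENT OF THE VOLUME: the
`1/c` of the Cauchy estimate remains, the volume factor `e^{a(c)ν}` of the domination branch
(`T4DilationAperture.act_family_lipschitz`, `sqrt_le_exp_volRate_div`) is gone. [folklore] -/
theorem pieceRatio_lipschitz [Std.Refl inc] [Std.Symm inc] {w : P → ℂ → ℂ} {a : P → ℝ} {Λ D : Finset P}
    {U : Set ℂ} {t₀ c : ℝ} (ht₀ : 0 < t₀) (hc0 : 0 < c) (hU : ∀ s ∈ Set.Ici t₀, closedBall (s : ℂ) (c * s) ⊆ U)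
    (hw : ∀ γ ∈ Λ, DifferentiableOn ℂ (w γ) U) (h : IsKPOn inc w a Λ U) (hD : D ⊆ Λ) {s s' : ℝ} (hs : t₀ ≤ s)
    (hs' : t₀ ≤ s') :
    ‖pieceRatio inc w Λ D s - pieceRatio inc w Λ D s'‖ ≤ 4 * Real.exp (∑ γ ∈ D, a γ) / (c * t₀) * |s - s'| := by
  have hDab : ∀ u ∈ Icc (min s s') (max s s'), closedBall (u : ℂ) (c * t₀) ⊆ U := by
    intro u hu
    have hut : t₀ ≤ u := (le_min hs hs').trans hu.1
    exact (closedBall_subset_closedBall (mul_le_mul_of_nonneg_left hut hc0.le)).trans (hU u hut)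
  exact Literature.MathematicalPhysics.QuantumFieldTheory.Dimock2015.real_param_lipschitz (mul_pos hc0 ht₀)
    (differentiableOn_pieceRatio hw h D) (fun _ hz => norm_pieceRatio_le h hD hz) hDab
    ⟨min_le_left _ _, le_max_left _ _⟩ ⟨min_le_right _ _, le_max_right _ _⟩

/-- **ALL VOLUMES AT ONCE.**  For a polymer system on ANY index type with activities holomorphic on `U` and KP uniform on
`U` in every finite volume, the reduced activity of a fixed piece `D` has the SAME Lipschitz constant
`4·e^{Σ_D a}/(c·t₀)` in every volume `Λ ⊇ D`: the thermodynamic limit costs nothing on this branch. [folklore] -/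
theorem pieceRatio_lipschitz_allVolumes [Std.Refl inc] [Std.Symm inc] {w : P → ℂ → ℂ} {a : P → ℝ} {U : Set ℂ}
    {t₀ c : ℝ} (ht₀ : 0 < t₀) (hc0 : 0 < c) (hU : ∀ s ∈ Set.Ici t₀, closedBall (s : ℂ) (c * s) ⊆ U)
    (hw : ∀ γ, DifferentiableOn ℂ (w γ) U) (h : ∀ Λ : Finset P, IsKPOn inc w a Λ U) (D : Finset P) :
    ∀ Λ : Finset P, D ⊆ Λ → ∀ s s' : ℝ, t₀ ≤ s → t₀ ≤ s' →
      ‖pieceRatio inc w Λ D s - pieceRatio inc w Λ D s'‖ ≤ 4 * Real.exp (∑ γ ∈ D, a γ) / (c * t₀) * |s - s'| :=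
  fun Λ hD _ _ hs hs' => pieceRatio_lipschitz ht₀ hc0 hU (fun γ _ => hw γ) (h Λ) hD hs hs'

/-! ## §4  WHERE THE APERTURE WENT: the volume rate is charged PER POLYMER to the KP size function -/

omit [DecidableEq P] in
/-- **KP ON THE DISCS FROM DOMINATED DILATION.**  Suppose each complex activity is obtained by DOMINATION after complex
dilation of a block integral with `n γ` fluctuation variables — `‖w γ z‖ ≤ dilVol c (n γ) · B γ` on `U`, the shape of
`T4ComplexDilation.norm_act_le` with a real-coupling bound `B γ` — and the REAL data satisfy the KP condition with the size
function ENLARGED BY THE VOLUME RATE PER POLYMER: `Σ_{γ' ι γ} B γ' · e^{a γ' + a(c)·n γ'} ≤ a γ`.  Then KP holds uniformly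
on `U` for the complex activities.  The dilation's volume factor is paid polymer by polymer, out of the expansion's
exponential margin, and never aggregates into a factor extensive in the volume: the aperture condition of
`T4DilationAperture` (`a(c)·ν < κ`) has become LOCAL — `a(c)·(variables of γ)` against the decay of `B γ`. [folklore] -/
theorem isKPOn_of_dominated {w : P → ℂ → ℂ} {a B : P → ℝ} {n : P → ℕ} {Λ : Finset P} {U : Set ℂ} {c : ℝ}
    (hc : c ^ 2 < 1) (hdom : ∀ z ∈ U, ∀ γ ∈ Λ, ‖w γ z‖ ≤ dilVol c (n γ) * B γ)
    (hKP : ∀ γ ∈ Λ, ∑ γ' ∈ Λ with inc γ' γ, B γ' * Real.exp (a γ' + volRate c * n γ') ≤ a γ) :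
    IsKPOn inc w a Λ U := by
  intro z hz γ hγ
  refine le_trans (Finset.sum_le_sum fun γ' hγ' => ?_) (hKP γ hγ)
  have hγ'Λ : γ' ∈ Λ := (Finset.mem_filter.1 hγ').1
  unfold kpTerm
  calc ‖w γ' z‖ * Real.exp (a γ')
      ≤ dilVol c (n γ') * B γ' * Real.exp (a γ') :=
        mul_le_mul_of_nonneg_right (hdom z hz γ' hγ'Λ) (Real.exp_nonneg _)
    _ = B γ' * Real.exp (a γ' + volRate c * n γ') := by
        rw [dilVol_eq_exp hc, Real.exp_add]; ring

/-- **THE EXPANSION BRANCH, END TO END.**  Activities holomorphic on `U ⊇` discs, dominated per polymer by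
`dilVol c (n γ)·B γ`, real data KP with the per-polymer-enlarged size function ⇒ the reduced activity of every piece
`D ⊆ Λ` has the `hlast` shape with the VOLUME-UNIFORM constant `e^{Σ_D a}`. [folklore] -/
theorem pieceRatio_dilationAnalytic_of_dominated [Std.Refl inc] [Std.Symm inc] {w : P → ℂ → ℂ} {a B : P → ℝ}
    {n : P → ℕ} {Λ D : Finset P} {U : Set ℂ} {t₀ c : ℝ} (hc0 : 0 ≤ c) (hc : c < 1)
    (hU : ∀ s ∈ Set.Ici t₀, closedBall (s : ℂ) (c * s) ⊆ U) (hw : ∀ γ ∈ Λ, DifferentiableOn ℂ (w γ) U)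
    (hdom : ∀ z ∈ U, ∀ γ ∈ Λ, ‖w γ z‖ ≤ dilVol c (n γ) * B γ)
    (hKP : ∀ γ ∈ Λ, ∑ γ' ∈ Λ with inc γ' γ, B γ' * Real.exp (a γ' + volRate c * n γ') ≤ a γ) (hD : D ⊆ Λ) :
    ∃ Dm : Set ℂ, DifferentiableOn ℂ (pieceRatio inc w Λ D) Dm ∧
      (∀ z ∈ Dm, ‖pieceRatio inc w Λ D z‖ ≤ Real.exp (∑ γ ∈ D, a γ)) ∧
      ∀ s ∈ Set.Ici t₀, closedBall (s : ℂ) (c * s) ⊆ Dm :=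
  have hc2 : c ^ 2 < 1 := by nlinarith
  pieceRatio_dilationAnalytic hU hw (isKPOn_of_dominated hc2 hdom hKP) hD

/-- THE PER-POLYMER THRESHOLD (scalar form).  If the real bound of a polymer with `n ≤ ν·ℓ` variables and size `ℓ`
decays like `B ≤ K·e^{−κ₀ ℓ}`, then after charging the volume rate the effective decay rate is `κ₀ − a(c)·ν`:
`B·e^{a(c)·n} ≤ K·e^{−(κ₀ − a(c)ν)·ℓ}` — the SAME threshold structure `a(c)·ν < κ₀` as `T4DilationAperture.volRate_mul_lt_iff`,
now per polymer (local) instead of per unit of the final localised bound (global in the volume). [folklore] -/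
theorem dominated_weight_le {B K κ₀ ν ℓ c : ℝ} {n : ℕ} (hc : c ^ 2 < 1) (hK : 0 ≤ K) (hB : B ≤ K * Real.exp (-(κ₀ * ℓ)))
    (hn : (n : ℝ) ≤ ν * ℓ) :
    B * Real.exp (volRate c * n) ≤ K * Real.exp (-((κ₀ - volRate c * ν) * ℓ)) := by
  have ha := volRate_nonneg hc
  calc B * Real.exp (volRate c * n)
      ≤ K * Real.exp (-(κ₀ * ℓ)) * Real.exp (volRate c * n) :=
        mul_le_mul_of_nonneg_right hB (Real.exp_nonneg _)
    _ ≤ K * Real.exp (-(κ₀ * ℓ)) * Real.exp (volRate c * (ν * ℓ)) := by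
        refine mul_le_mul_of_nonneg_left (Real.exp_le_exp.2 ?_) (mul_nonneg hK (Real.exp_nonneg _))
        exact mul_le_mul_of_nonneg_left hn ha
    _ = K * Real.exp (-((κ₀ - volRate c * ν) * ℓ)) := by
        rw [mul_assoc, ← Real.exp_add]; congr 1; congr 1; ring

/-! ## §4b  The loop closed with generation 8 BY NAME: a polymer gas of genuine one-block integrals -/

section ActPolymers

variable {ιX : P → Type*} [∀ γ, Fintype (ιX γ)] [∀ γ, DecidableEq (ιX γ)] {Ω : P → Type*}
  [∀ γ, MeasurableSpace (Ω γ)]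

omit [DecidableEq P] in
/-- **POLYMER ACTIVITIES = THE ONE-BLOCK INTEGRALS OF `T4ComplexDilation`, DOMINATED ON THE DILATION DOMAIN.**  If the
activity of the polymer `γ` is the model activity `act (A γ) (μ γ) (f γ) (S γ)` of generation 8 (`card (ιX γ)` fluctuation
variables) and its real-coupling absolute-value functional is bounded by `B γ` for `r ≥ (1 − c)t₀` (the printed KIND of
input), then on the dilation domain `dilDom t₀ c ⊇` all discs the complex activity is dominated by `dilVol c (card ιX γ)·B γ`
(`norm_act_le` BY NAME) — hypothesis `hdom` of `isKPOn_of_dominated`. [folklore] -/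
theorem act_dominated_on_dilDom (A : ∀ γ, Matrix (ιX γ) (ιX γ) ℝ) (hA : ∀ γ, (A γ).PosDef) (μ : ∀ γ, Measure (Ω γ))
    (f : ∀ γ, Ω γ → ℂ) (S : ∀ γ, Ω γ → ℝ) {B : P → ℝ} {t₀ c : ℝ} (ht₀ : 0 < t₀) (hc : c < 1) (Λ : Finset P)
    (hB : ∀ γ ∈ Λ, ∀ r : ℝ, (1 - c) * t₀ ≤ r → absAct (A γ) (μ γ) (f γ) (S γ) r ≤ B γ) :
    ∀ z ∈ dilDom t₀ c, ∀ γ ∈ Λ,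
      ‖act (A γ) (μ γ) (f γ) (S γ) z‖ ≤ dilVol c (Fintype.card (ιX γ)) * B γ := by
  rintro z ⟨s, hs, hz⟩ γ hγ
  have hc2 : c ^ 2 < 1 := by
    have hs0 : 0 < s := lt_of_lt_of_le ht₀ hs
    have hc0 : -1 < c := by
      by_contra h
      have h1 : ‖z - s‖ ≤ c * s := hz
      have h2 : 0 ≤ ‖z - (s : ℂ)‖ := norm_nonneg _
      nlinarith
    nlinarith
  have hre : 0 < z.re := re_pos_of_mem_dilDisc ht₀ hc hs hz
  refine (norm_act_le (A γ) (hA γ) (μ γ) (f γ) (S γ) hre hc2 (normSq_mul_le_re_sq_of_mem_dilDisc hz)).trans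
    (mul_le_mul_of_nonneg_left (hB γ hγ _ ?_) (dilVol_nonneg _ _))
  calc (1 - c) * t₀ ≤ (1 - c) * s := mul_le_mul_of_nonneg_left hs (by linarith)
    _ ≤ z.re := re_ge_of_mem_dilDisc hz

/-- **THE EXPANSION BRANCH ON GENERATION 8's OBJECTS.**  A polymer gas whose activities are genuine one-block integrals
`act (A γ) (μ γ) (f γ) (S γ)` (integrable insertions, bounded measurable actions), with real-coupling bounds `B γ` on
`r ≥ (1 − c)t₀` and REAL data satisfying KP with the size function enlarged by `a(c)·card(ιX γ)` per polymer: then for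
every piece `D ⊆ Λ` the reduced activity has the `hlast` shape on the dilation discs with the VOLUME-UNIFORM constant
`e^{Σ_D a}` — the same one-block integrals whose domination bound ALONE forces `a(c)·ν < κ` globally
(`T4DilationAperture.act_family_dilationAnalytic`, `witness_no_decay`) cost only a per-polymer enlargement of the KP size
function once an expansion organises them.  ASSERTS NOTHING about Bałaban's expansions. [folklore] -/
theorem act_polymerGas_dilationAnalytic [Std.Refl inc] [Std.Symm inc] (A : ∀ γ, Matrix (ιX γ) (ιX γ) ℝ)
    (hA : ∀ γ, (A γ).PosDef) (μ : ∀ γ, Measure (Ω γ)) {f : ∀ γ, Ω γ → ℂ} (hf : ∀ γ, Integrable (f γ) (μ γ))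
    {S : ∀ γ, Ω γ → ℝ} (hS : ∀ γ, Measurable (S γ)) {S₀ : P → ℝ} (hS₀ : ∀ γ x, |S γ x| ≤ S₀ γ) {a B : P → ℝ}
    {t₀ c : ℝ} (ht₀ : 0 < t₀) (hc0 : 0 ≤ c) (hc : c < 1) {Λ D : Finset P}
    (hB : ∀ γ ∈ Λ, ∀ r : ℝ, (1 - c) * t₀ ≤ r → absAct (A γ) (μ γ) (f γ) (S γ) r ≤ B γ)
    (hKP : ∀ γ ∈ Λ, ∑ γ' ∈ Λ with inc γ' γ, B γ' * Real.exp (a γ' + volRate c * Fintype.card (ιX γ')) ≤ a γ)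
    (hD : D ⊆ Λ) :
    ∃ Dm : Set ℂ, DifferentiableOn ℂ (pieceRatio inc (fun γ => act (A γ) (μ γ) (f γ) (S γ)) Λ D) Dm ∧
      (∀ z ∈ Dm, ‖pieceRatio inc (fun γ => act (A γ) (μ γ) (f γ) (S γ)) Λ D z‖ ≤ Real.exp (∑ γ ∈ D, a γ)) ∧
      ∀ s ∈ Set.Ici t₀, closedBall (s : ℂ) (c * s) ⊆ Dm :=
  pieceRatio_dilationAnalytic_of_dominated (U := dilDom t₀ c) (n := fun γ => Fintype.card (ιX γ)) hc0 hc
    (fun _ hs => closedBall_subset_dilDom (Set.mem_Ici.1 hs))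
    (fun γ _ => (differentiableOn_act (A γ) (hf γ) (hS γ) (hS₀ γ)).mono (dilDom_subset_re_pos ht₀ hc))
    (act_dominated_on_dilDom A hA μ f S ht₀ hc Λ hB) hKP hD

end ActPolymers

/-! ## §5  Non-vacuity: a one-polymer system satisfying uniform KP on the right half-plane -/

/-- The total incompatibility relation on a one-polymer system. [folklore] -/
def topInc : Unit → Unit → Prop := fun _ _ => True

/-- `topInc` is decidable. [folklore] -/
instance instDecidableRelTopInc : DecidableRel topInc := fun _ _ => inferInstanceAs (Decidable True)

/-- `topInc` is reflexive (a polymer is incompatible with itself). [folklore] -/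
instance instReflTopInc : Std.Refl topInc := ⟨fun _ => trivial⟩

/-- `topInc` is symmetric. [folklore] -/
instance instSymmTopInc : Std.Symm topInc := ⟨fun _ _ _ => trivial⟩

/-- Activities `w () z = ε·e^{−z}`: entire, of modulus `≤ ε` on the closed right half-plane. [folklore] -/
def expActivity (ε : ℝ) : Unit → ℂ → ℂ := fun _ z => (ε : ℂ) * Complex.exp (-z)

/-- **NON-VACUITY.**  For `0 ≤ ε ≤ e^{−1}` the one-polymer system with activity `ε·e^{−z}` satisfies the KP condition with
size function `a ≡ 1` UNIFORMLY on the closed right half-plane (which contains every dilation disc with `c ≤ 1`):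
`‖ε e^{−z}‖·e ≤ ε·e ≤ 1`.  So the hypotheses of §§2–3 are inhabited by a genuine holomorphic family. [folklore] -/
theorem isKPOn_expActivity {ε : ℝ} (hε0 : 0 ≤ ε) (hε : ε ≤ Real.exp (-1)) (Λ : Finset Unit) :
    IsKPOn topInc (expActivity ε) (fun _ => 1) Λ {z : ℂ | 0 ≤ z.re} := by
  intro z hz γ hγ
  have hterm : ∀ γ' : Unit, kpTerm (fun γ => expActivity ε γ z) (fun _ => (1 : ℝ)) γ' ≤ Real.exp (-1) * Real.exp 1 := by
    intro γ'
    unfold kpTerm expActivity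
    refine mul_le_mul_of_nonneg_right ?_ (Real.exp_nonneg _)
    rw [norm_mul, Complex.norm_real, Real.norm_eq_abs, abs_of_nonneg hε0, Complex.norm_exp, Complex.neg_re]
    calc ε * Real.exp (-z.re) ≤ ε * 1 :=
          mul_le_mul_of_nonneg_left (Real.exp_le_one_iff.2 (by simpa using hz)) hε0
      _ ≤ Real.exp (-1) := by simpa using hε
  have hcard : (Λ.filter fun γ' => topInc γ' γ).card ≤ 1 :=
    (Finset.card_le_card (Finset.filter_subset _ _)).trans (Finset.card_le_univ Λ |>.trans (by simp))
  calc ∑ γ' ∈ Λ with topInc γ' γ, kpTerm (fun γ => expActivity ε γ z) (fun _ => (1 : ℝ)) γ'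
      ≤ ∑ γ' ∈ Λ with topInc γ' γ, Real.exp (-1) * Real.exp 1 := Finset.sum_le_sum fun γ' _ => hterm γ'
    _ = (Λ.filter fun γ' => topInc γ' γ).card * (Real.exp (-1) * Real.exp 1) := by
        rw [Finset.sum_const, nsmul_eq_mul]
    _ ≤ 1 * (Real.exp (-1) * Real.exp 1) := by
        refine mul_le_mul_of_nonneg_right ?_ (by positivity)
        exact_mod_cast hcard
    _ = 1 := by rw [← Real.exp_add]; norm_num

/-- The activities of the example are entire. [folklore] -/
theorem differentiable_expActivity (ε : ℝ) (γ : Unit) : Differentiable ℂ (expActivity ε γ) := by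
  unfold expActivity
  exact (differentiable_const _).mul (Complex.differentiable_exp.comp differentiable_neg)

/-- The closed right half-plane contains every dilation disc `|z − s| ≤ c·s`, `s ≥ t₀ > 0`, `0 ≤ c < 1`
(`T4ComplexDilation.dilDom_subset_re_pos`). [folklore] -/
theorem closedBall_subset_halfPlane {t₀ c : ℝ} (ht₀ : 0 < t₀) (hc : c < 1) :
    ∀ s ∈ Set.Ici t₀, closedBall (s : ℂ) (c * s) ⊆ {z : ℂ | 0 ≤ z.re} :=
  fun s hs z hz => by
    have h : 0 < z.re := dilDom_subset_re_pos ht₀ hc (closedBall_subset_dilDom (Set.mem_Ici.1 hs) hz)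
    exact h.le

/-- **THE EXAMPLE DISCHARGES §3 BY NAME**: for `0 < t₀`, `0 < c < 1`, `0 ≤ ε ≤ e^{−1}`, the reduced activity of the piece
`{()}` in the one-polymer system — `ρ(z) = 1/(1 + ε e^{−z})` — is Lipschitz in the real coupling on `[t₀, ∞[` with
constant `4e/(c t₀)`, by `pieceRatio_lipschitz`. [folklore] -/
theorem expActivity_lipschitz {ε t₀ c : ℝ} (hε0 : 0 ≤ ε) (hε : ε ≤ Real.exp (-1)) (ht₀ : 0 < t₀) (hc0 : 0 < c)
    (hc : c < 1) {s s' : ℝ} (hs : t₀ ≤ s) (hs' : t₀ ≤ s') :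
    ‖pieceRatio topInc (expActivity ε) {()} {()} s - pieceRatio topInc (expActivity ε) {()} {()} s'‖
      ≤ 4 * Real.exp (∑ _γ ∈ ({()} : Finset Unit), (1 : ℝ)) / (c * t₀) * |s - s'| :=
  pieceRatio_lipschitz ht₀ hc0 (closedBall_subset_halfPlane ht₀ hc)
    (fun γ _ => (differentiable_expActivity ε γ).differentiableOn) (isKPOn_expActivity hε0 hε _)
    (Finset.Subset.refl _) hs hs'

end Literature.MathematicalPhysics.QuantumFieldTheory.Balaban1983to89.T4DilationKP
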